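import Summits.HodgeConjecture.CorCM.CyclotomicFieldsOddPartClassification
import Summits.HodgeConjecture.CorCM.ThinTwoGroupObstructions
import Summits.HodgeConjecture.CorCM.TotientTwoPowerArithmetic
import Literature.AlgebraicGeometry.ComplexMultiplication.CyclotomicCMTypeResidueSets
import HarnessLib

/-!
# Cyclotomic fields of `2`-power degree, and the complete list of cyclotomic fields all of whose simple CM
# abelian varieties are nondegenerate

COR-CM (cell `pub-hodgecm2`), binder seat b04 (gen 18), count-neutral claim ABELIAN-ODD-PART, sequel CYCLOTOMIC-2POWER,
part B.  KERNEL ONLY: theorems; no definition, no named fact, no `sorry`.  `HC_CM` is neither used nor claimed.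

Gen 16 classified the abelian CM fields of `2`-power degree by (α) THIN (`c` in a cyclic subgroup of index `≤ 2`),
(β) degree `≤ 8`, (γ) degree `16` with all squares in `{1, c}`.  For `L = ℚ(ζ_N)`, `φ(N) = 2^{n+1}`, read on
`Gal(L/ℚ) ≅ (ℤ/N)ˣ` (complex conjugation `↦ −1`, `autResidue_complexConj`):

* (γ) NEVER holds (`not_gamma_cyclotomic`): all squares in `{±1}` would force `7⁴ ≡ 11⁴ ≡ 1 (mod N)` (`7, 11` are
  units, since `p − 1 ∣ φ(N) = 16` excludes `p = 7, 11`), i.e. `N ∣ 240`, and the divisors of `240` with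
  `φ = 16` are `40, 48, 60`, where `3², 5², 7² ∉ {±1}` respectively;
* (α) holds iff `(ℤ/N)ˣ` is CYCLIC (`thin_iff_isCyclic_cyclotomic`, for `φ(N) ≥ 16`): a thin NON-cyclic Galois
  group would make `−1` a `2^{n−1}`-th power mod `N` (part A, `exists_pow_eq_of_thin`) — impossible mod `4` and
  mod `3` (squares), and impossible when `N` has two odd prime factors `p ≠ q` (then `p, q ≡ 1 (mod 4)` are Fermat
  primes, `4(p−1) ∣ φ(N)` and Fermat's little theorem gives `−1 ≡ 1 (mod p)`).

**Theorem (`forall_isPrimitive_isNondegenerate_iff_cyclotomic_two_power`).**  `φ(N) = 2^{n+1}`, `N ≥ 3`: every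
primitive CM type of `ℚ(ζ_N)` is nondegenerate **iff `φ(N) ≤ 8` or `(ℤ/N)ˣ` is cyclic** (i.e. `N = p, 2p` for a
Fermat prime `p`, or `N = 4`).  With part IV (odd part) this is **the complete list of cyclotomic fields all of
whose simple CM abelian varieties are nondegenerate** (`forall_isSimple_isNondegenerate_iff_cyclotomic_all`):
`φ(N) = 2^{a+1} m`, `m` odd ⟹ (all simple nondegenerate) ⟺ (`m = 1` ∧ `φ(N) ≤ 8`) ∨ (`(ℤ/N)ˣ` cyclic ∧
(`m = 1` ∨ `m` prime)); e.g. good: `N ≤ 24` except `21`; `ℚ(ζ_p)` with `p − 1 = 2^s q`; `ℚ(ζ_9)`, `ℚ(ζ_{25})`,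
`ℚ(ζ_{289})`; bad: `ℚ(ζ_{32})`, `ℚ(ζ_{40})`, `ℚ(ζ_{48})`, `ℚ(ζ_{51})`, `ℚ(ζ_{60})`, `ℚ(ζ_{64})`, `ℚ(ζ_{68})`,
`ℚ(ζ_{85})`, every conductor with two odd prime factors.

## References

* [Gordon1999HodgeAVSurvey] B. B. Gordon, *A survey of the Hodge conjecture for abelian varieties*, §9.4.2–9.4.3.
* [Washington1997] L. C. Washington, *Introduction to Cyclotomic Fields*, Thm. 2.5.
* [Kubota1965] T. Kubota, *On the field extension by complex multiplication*, Trans. AMS 118 (1965), §4 Lemma 2.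
* [Shimura1998] G. Shimura, *Abelian Varieties with Complex Multiplication and Modular Functions*, §8.2 Prop. 26.
-/

noncomputable section

open CategoryTheory CategoryTheory.Limits NumberField Polynomial

namespace Summit.HodgeConjecture.CorCM.AbelianOddPart

open Literature.NumberTheory.ComplexMultiplication
open Literature.AlgebraicGeometry.Motives (AbelianVariety CMType)
open Literature.AlgebraicGeometry.HodgeTheory
open Literature.AlgebraicGeometry.ComplexMultiplication (IsCMTypeRealisation isSimple_iff_isPrimitive)
open Literature.AlgebraicGeometry.ComplexMultiplication.CyclotomicCMTypeResidueSets
open Literature.AlgebraicGeometry.Pohlmann1968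
open Literature.AlgebraicGeometry.Pohlmann1968.Cyclotomic
open Literature.Barriers.HodgeConjecture (divisorClassesSpan)
open Summit.HodgeConjecture.CorCM.ThinObstruction
open Summit.HodgeConjecture.CorCM.TotientTwoPower

open scoped Classical

/-! ## §1 `ℚ(ζ_N)`: complex conjugation has residue `−1`; (γ) never holds; thin ⟺ cyclic -/

section Field

variable {L : Type} [Field L] [NumberField L]

/-- `a(1) = 1`. [folklore] -/
theorem autResidue_one (N : ℕ) [NeZero N] [IsCyclotomicExtension {N} ℚ L] : autResidue N L 1 = 1 := by
  simp [autResidue, map_one]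

/-- `a(γ^n) = a(γ)^n`. [folklore] -/
theorem autResidue_pow (N : ℕ) [NeZero N] [IsCyclotomicExtension {N} ℚ L] (γ : L ≃ₐ[ℚ] L) (n : ℕ) :
    autResidue N L (γ ^ n) = autResidue N L γ ^ n := by
  induction n with
  | zero => rw [pow_zero, pow_zero, autResidue_one]
  | succ n ih => rw [pow_succ, pow_succ, autResidue_mul, ih]

/-- **Complex conjugation acts on `ζ_N` by `ζ_N ↦ ζ_N^{−1}`: `a(c) = −1`.** [cite: Washington1997, Thm. 2.5] -/
theorem autResidue_complexConj (N : ℕ) [NeZero N] [IsCyclotomicExtension {N} ℚ L] [IsCMField L] :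
    autResidue N L ((IsCMField.complexConj L).restrictScalars ℚ) = -1 := by
  obtain ⟨σ⟩ := (inferInstance : Nonempty (L →+* ℂ))
  set c : L ≃ₐ[ℚ] L := (IsCMField.complexConj L).restrictScalars ℚ with hc
  have hcomp : σ.comp (c : L →+* L) = ComplexEmbedding.conjugate σ := by
    refine RingHom.ext fun x => ?_
    rw [RingHom.comp_apply, ComplexEmbedding.conjugate_coe_eq, RingHom.coe_coe, hc, AlgEquiv.restrictScalars_apply]
    exact IsCMField.complexEmbedding_complexConj L σ x
  have h := expOf_comp_algEquiv N σ c
  rw [hcomp, expOf_conjugate] at h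
  -- cancel the unit `e(σ)`
  have hunit : IsUnit (expOf N L σ) := by
    rw [← ZMod.natCast_zmod_val (expOf N L σ)]
    exact (ZMod.isUnit_iff_coprime _ _).2 (coprime_expOf N L σ)
  have h' : expOf N L σ * autResidue N L c = expOf N L σ * (-1) := by rw [← h, mul_neg_one]
  exact hunit.mul_left_cancel h'

/-- A unit residue `u` is `a(γ)` for some `γ`; squares of Galois elements read on residues. (γ) of gen 16 for
`ℚ(ζ_N)` would say: every unit residue squares to `±1`. [cite: Washington1997, Thm. 2.5] -/
theorem sq_eq_or_of_gamma (N : ℕ) [NeZero N] [IsCyclotomicExtension {N} ℚ L] [IsCMField L]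
    (hγ : ∀ g : L ≃ₐ[ℚ] L, g * g = 1 ∨ g * g = (IsCMField.complexConj L).restrictScalars ℚ)
    (u : ZMod N) (hu : u.val.Coprime N) : u * u = 1 ∨ u * u = -1 := by
  obtain ⟨γ, hγu⟩ := exists_autResidue_eq N (L := L) u ((coprime_iff_mem_unitResidues N u).1 hu)
  rw [← hγu, ← autResidue_mul]
  rcases hγ γ with h | h
  · exact Or.inl (by rw [h, autResidue_one])
  · exact Or.inr (by rw [h, autResidue_complexConj])

/-- **(γ) never holds for a cyclotomic field of degree `16`.** [cite: Washington1997, Thm. 2.5]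
[cite: Gordon1999HodgeAVSurvey, §9.4.2] -/
theorem not_gamma_cyclotomic {N : ℕ} (hN : 3 ≤ N) (hφ : N.totient = 16) [IsCyclotomicExtension {N} ℚ L]
    [IsCMField L] :
    ¬ ∀ g : L ≃ₐ[ℚ] L, g * g = 1 ∨ g * g = (IsCMField.complexConj L).restrictScalars ℚ := by
  haveI : NeZero N := ⟨by omega⟩
  intro hγ
  have hsq := sq_eq_or_of_gamma N hγ
  have hpow4 : ∀ u : ZMod N, u.val.Coprime N → u ^ 4 = 1 := by
    intro u hu
    rw [show (4 : ℕ) = 2 * 2 by norm_num, pow_mul, pow_two u]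
    rcases hsq u hu with h | h <;> rw [h] <;> norm_num
  obtain ⟨h7, h11⟩ := not_seven_dvd_not_eleven_dvd (k := 4) (by rw [hφ]; norm_num)
  have hdvd : ∀ a : ℕ, Nat.Coprime a N → N ∣ a ^ 4 - 1 := by
    intro a ha
    have hval : ((a : ZMod N)).val.Coprime N := by
      rw [ZMod.val_natCast, Nat.coprime_iff_gcd_eq_one, ← Nat.gcd_rec, Nat.gcd_comm]
      exact Nat.coprime_iff_gcd_eq_one.1 ha
    have h := hpow4 (a : ZMod N) hval
    have h1 : ((a ^ 4 : ℕ) : ZMod N) = ((1 : ℕ) : ZMod N) := by push_cast; exact h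
    rw [ZMod.natCast_eq_natCast_iff'] at h1
    have ha1 : 1 ≤ a ^ 4 := Nat.one_le_pow _ _ (Nat.pos_of_ne_zero fun h0 => by
      rw [h0] at ha; simp at ha; omega)
    exact (Nat.modEq_iff_dvd' ha1).1 h1.symm
  have hc7 : Nat.Coprime 7 N := (Nat.Prime.coprime_iff_not_dvd (by norm_num)).2 h7
  have hc11 : Nat.Coprime 11 N := (Nat.Prime.coprime_iff_not_dvd (by norm_num)).2 h11
  have h240 : N ∣ 240 := by
    have h1 := hdvd 7 hc7
    have h2 := hdvd 11 hc11
    norm_num at h1 h2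
    have := Nat.dvd_gcd h1 h2
    norm_num at this
    exact this
  -- `N ∈ {40, 48, 60}`: explicit units with squares outside `{±1}`
  rcases eq_of_dvd_240_of_totient h240 hφ with rfl | rfl | rfl
  · have := hsq 3 (by decide); revert this; decide
  · have := hsq 5 (by decide); revert this; decide
  · have := hsq 7 (by decide); revert this; decide

/-- **For `ℚ(ζ_N)` with `φ(N) = 2^k ≥ 16`: THIN (α) ⟹ `(ℤ/N)ˣ` cyclic.**  A thin non-cyclic Galois group makes
`−1 = a(w)^{2^{k−2}}` mod `N` (part A); this is a square, impossible when `4 ∣ N` or `3 ∣ N`; otherwise two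
distinct Fermat primes `p, q ≥ 5` divide `N` and `−1 ≡ 1 (mod p)` by Fermat's little theorem.
[cite: Gordon1999HodgeAVSurvey, §9.4.3] [cite: Washington1997, Thm. 2.5] -/
theorem isCyclic_of_thin_cyclotomic {N k : ℕ} (hN : 3 ≤ N) (hφ : N.totient = 2 ^ k) (hk : 4 ≤ k)
    [IsCyclotomicExtension {N} ℚ L] [IsCMField L] [IsGalois ℚ L]
    (hcomm : ∀ g h : L ≃ₐ[ℚ] L, g * h = h * g) (hfin : Module.finrank ℚ L = N.totient)
    (hα : ∃ z : L ≃ₐ[ℚ] L, (IsCMField.complexConj L).restrictScalars ℚ ∈ Subgroup.zpowers z ∧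
      (Subgroup.zpowers z).index ≤ 2) : IsCyclic (ZMod N)ˣ := by
  haveI : NeZero N := ⟨by omega⟩
  letI : CommGroup (L ≃ₐ[ℚ] L) := { (inferInstance : Group (L ≃ₐ[ℚ] L)) with mul_comm := hcomm }
  by_contra hnc
  obtain ⟨z, hcz, hidx⟩ := hα
  set c : L ≃ₐ[ℚ] L := (IsCMField.complexConj L).restrictScalars ℚ with hc
  have hcard : Fintype.card (L ≃ₐ[ℚ] L) = 2 ^ k := by
    rw [← Nat.card_eq_fintype_card, IsGalois.card_aut_eq_finrank, hfin, hφ]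
  obtain ⟨w, hw⟩ := exists_pow_eq_of_thin hcard (by omega) (GaloisOctic.complexConj_mul_self (K := L)) hcz hidx
  -- on residues: `a(w)^{2^{k-2}} = -1`
  have hres : autResidue N L w ^ 2 ^ (k - 2) = -1 := by
    rw [← autResidue_pow, hw]
    exact autResidue_complexConj N
  have hunitw : (autResidue N L w).val.Coprime N := (coprime_iff_mem_unitResidues N _).2 (autResidue_mem_unitResidues N w)
  -- a square: `2^{k-2} = 2 · 2^{k-3}`
  have hsq : (autResidue N L w ^ 2 ^ (k - 3)) * (autResidue N L w ^ 2 ^ (k - 3)) = -1 := by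
    rw [← pow_add, ← two_mul, ← pow_succ', show k - 3 + 1 = k - 2 by omega, hres]
  by_cases h4 : 4 ∣ N
  · exact mul_self_ne_neg_one_of_four_dvd h4 _ hsq
  by_cases h3 : 3 ∣ N
  · exact mul_self_ne_neg_one_of_three_dvd h3 _ hsq
  obtain ⟨p, q, hp, hq, hpq, hpN, hqN, hp2, hp3, hq2, hq3⟩ := exists_two_primes_of_not_isCyclic hN h4 h3 hnc
  exact pow_ne_neg_one_of_two_primes hφ hp hq hpq hpN hqN hp2 hp3 hq2 hq3 hunitw hres

/-- **THE CYCLOTOMIC CLASSIFICATION, `2`-power degree.**  `L = ℚ(ζ_N)`, `N ≥ 3`, `φ(N) = 2^{n+1}`: every PRIMITIVE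
CM type of `L` is nondegenerate **iff `φ(N) ≤ 8` or `(ℤ/N)ˣ` is cyclic** (i.e. `N ∈ {p, 2p}` for a Fermat prime
`p ≥ 17`, besides the small conductors). [cite: Kubota1965, §4 Lemma 2] [cite: Gordon1999HodgeAVSurvey, §9.4.3]
[cite: Washington1997, Thm. 2.5] [cite: Shimura1998, §8.2 Prop. 26] -/
theorem forall_isPrimitive_isNondegenerate_iff_cyclotomic_two_power {N n : ℕ} (hN : 3 ≤ N)
    (hφ : N.totient = 2 ^ (n + 1)) [IsCyclotomicExtension {N} ℚ L] (φ₀ : L →+* ℂ) :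
    (∀ Φ : CMType L, IsPrimitive (ℂ ≃+* ℂ) Φ.1 φ₀ → IsNondegenerate Φ) ↔
      N.totient ≤ 8 ∨ IsCyclic (ZMod N)ˣ := by
  obtain ⟨hcm, hgal, hcomm, hcyc, hfin⟩ := cyclotomic_data hN L
  haveI := hcm
  haveI := hgal
  have hK : Module.finrank ℚ L = 2 ^ (n + 1) := hfin.trans hφ
  rw [AbelianTwoPowerClassification.forall_isPrimitive_isNondegenerate_iff hcomm hK φ₀, hK, ← hφ]
  constructor
  · rintro (hα | hβ | ⟨h16, hγ⟩)
    · by_cases h8 : N.totient ≤ 8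
      · exact Or.inl h8
      · refine Or.inr (isCyclic_of_thin_cyclotomic hN hφ ?_ hcomm hfin hα)
        by_contra hk
        have : 2 ^ (n + 1) ≤ 2 ^ 3 := Nat.pow_le_pow_right two_pos (by omega)
        omega
    · exact Or.inl hβ
    · exact absurd hγ (not_gamma_cyclotomic hN h16)
  · rintro (h8 | hc)
    · exact Or.inr (Or.inl h8)
    · obtain ⟨z, hz⟩ := (hcyc.2 hc).exists_generator
      refine Or.inl ⟨z, hz _, ?_⟩
      have htop : Subgroup.zpowers z = ⊤ := (Subgroup.eq_top_iff' _).2 hz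
      rw [htop, Subgroup.index_top]
      norm_num

/-- **Bad `2`-power cyclotomic fields: `φ(N) = 2^{n+1} > 8` and `(ℤ/N)ˣ` not cyclic ⟹ a SIMPLE DEGENERATE CM
abelian variety of dimension `φ(N)/2` with CM by `ℚ(ζ_N)`**, with an exceptional Hodge class (rational, of type `(k,k)`,
outside the complexified divisor ring) on some power. [cite: Shimura1998, §6.2 Thm. 3 and §8.2 Prop. 26]
[cite: Gordon1999HodgeAVSurvey, §9.4.3] -/
theorem exists_simple_degenerate_cyclotomic_two_power {N n : ℕ} (hN : 3 ≤ N) (hφ : N.totient = 2 ^ (n + 1))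
    (h8 : 8 < N.totient) (hnc : ¬ IsCyclic (ZMod N)ˣ) [IsCyclotomicExtension {N} ℚ L] :
    ∃ (Φ : CMType L) (φ₀ : L →+* ℂ) (A : AbelianVariety ℂ) (ι : 𝓞 L →+* End A)
      (θ : L →+* Module.End ℂ (complexBetti A.X 1)),
      IsPrimitive (ℂ ≃+* ℂ) Φ.1 φ₀ ∧ ¬ IsNondegenerate Φ ∧ IsCMTypeRealisation Φ A ι θ ∧ A.IsSimple ∧
      A.dim = 2 ^ n ∧
      ∃ M k : ℕ, ∃ x : complexBetti (⨁ fun _ : Fin M => A).X (2 * k), IsRationalClass x ∧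
        IsOfHodgeType (⨁ fun _ : Fin M => A).dim (⨁ fun _ : Fin M => A).X (2 * k) k k x ∧
        x ∉ divisorClassesSpan (⨁ fun _ : Fin M => A).X (⨁ fun _ : Fin M => A).dim k := by
  obtain ⟨hcm, hgal, -, -, hfin⟩ := cyclotomic_data hN L
  haveI := hcm
  haveI := hgal
  obtain ⟨φ₀⟩ := (inferInstance : Nonempty (L →+* ℂ))
  have h := (forall_isPrimitive_isNondegenerate_iff_cyclotomic_two_power hN hφ φ₀).not.2
    (not_or.2 ⟨not_le.2 h8, hnc⟩)
  push Not at h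
  obtain ⟨Φ, hprim, hdeg⟩ := h
  obtain ⟨A, ι, θ, hA, hs, hdim⟩ := AbelianSixteen.exists_simple_realisation_of_isPrimitive Φ φ₀ hprim
  refine ⟨Φ, φ₀, A, ι, θ, hprim, hdeg, hA, hs, ?_, exists_exceptional_pow_of_not_isNondegenerate φ₀ hprim hdeg hA⟩
  rw [hdim, hfin, hφ, pow_succ, Nat.mul_div_cancel _ (by norm_num : 0 < 2)]

/-- **`ℚ(ζ₅₁)`** (`φ = 32`, `(ℤ/51)ˣ ≅ ℤ/2 × ℤ/16`, not thin): simple DEGENERATE CM `16`-folds with exceptional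
Hodge classes exist. [cite: Shimura1998, §6.2 Thm. 3] [cite: Gordon1999HodgeAVSurvey, §9.4.3] -/
theorem exists_simple_degenerate_cyclotomic_fiftyOne [IsCyclotomicExtension {51} ℚ L] :
    ∃ (Φ : CMType L) (φ₀ : L →+* ℂ) (A : AbelianVariety ℂ) (ι : 𝓞 L →+* End A)
      (θ : L →+* Module.End ℂ (complexBetti A.X 1)),
      IsPrimitive (ℂ ≃+* ℂ) Φ.1 φ₀ ∧ ¬ IsNondegenerate Φ ∧ IsCMTypeRealisation Φ A ι θ ∧ A.IsSimple ∧
      A.dim = 2 ^ 4 ∧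
      ∃ M k : ℕ, ∃ x : complexBetti (⨁ fun _ : Fin M => A).X (2 * k), IsRationalClass x ∧
        IsOfHodgeType (⨁ fun _ : Fin M => A).dim (⨁ fun _ : Fin M => A).X (2 * k) k k x ∧
        x ∉ divisorClassesSpan (⨁ fun _ : Fin M => A).X (⨁ fun _ : Fin M => A).dim k :=
  exists_simple_degenerate_cyclotomic_two_power (N := 51) (by norm_num) (by decide) (by decide)
    (ZMod.not_isCyclic_units_of_mul_coprime 3 17 (by decide) (by norm_num) (by decide) (by norm_num) (by norm_num))

/-- **`ℚ(ζ₆₈)`** (`φ = 32`, `(ℤ/68)ˣ ≅ ℤ/2 × ℤ/16`): simple degenerate CM `16`-folds with exceptional classes exist.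
[cite: Shimura1998, §6.2 Thm. 3] [cite: Gordon1999HodgeAVSurvey, §9.4.3] -/
theorem exists_simple_degenerate_cyclotomic_sixtyEight [IsCyclotomicExtension {68} ℚ L] :
    ∃ (Φ : CMType L) (φ₀ : L →+* ℂ) (A : AbelianVariety ℂ) (ι : 𝓞 L →+* End A)
      (θ : L →+* Module.End ℂ (complexBetti A.X 1)),
      IsPrimitive (ℂ ≃+* ℂ) Φ.1 φ₀ ∧ ¬ IsNondegenerate Φ ∧ IsCMTypeRealisation Φ A ι θ ∧ A.IsSimple ∧
      A.dim = 2 ^ 4 ∧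
      ∃ M k : ℕ, ∃ x : complexBetti (⨁ fun _ : Fin M => A).X (2 * k), IsRationalClass x ∧
        IsOfHodgeType (⨁ fun _ : Fin M => A).dim (⨁ fun _ : Fin M => A).X (2 * k) k k x ∧
        x ∉ divisorClassesSpan (⨁ fun _ : Fin M => A).X (⨁ fun _ : Fin M => A).dim k :=
  exists_simple_degenerate_cyclotomic_two_power (N := 68) (by norm_num) (by decide) (by decide)
    (not_isCyclic_units_of_four_dvd (by norm_num) (by norm_num) (by norm_num))

/-- **`ℚ(ζ₈₅)`** (`φ = 64`, `(ℤ/85)ˣ ≅ ℤ/4 × ℤ/16`; `−1` IS a square mod `85` — the Fermat obstruction is needed):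
simple degenerate CM `32`-folds with exceptional classes exist. [cite: Shimura1998, §6.2 Thm. 3]
[cite: Gordon1999HodgeAVSurvey, §9.4.3] -/
theorem exists_simple_degenerate_cyclotomic_eightyFive [IsCyclotomicExtension {85} ℚ L] :
    ∃ (Φ : CMType L) (φ₀ : L →+* ℂ) (A : AbelianVariety ℂ) (ι : 𝓞 L →+* End A)
      (θ : L →+* Module.End ℂ (complexBetti A.X 1)),
      IsPrimitive (ℂ ≃+* ℂ) Φ.1 φ₀ ∧ ¬ IsNondegenerate Φ ∧ IsCMTypeRealisation Φ A ι θ ∧ A.IsSimple ∧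
      A.dim = 2 ^ 5 ∧
      ∃ M k : ℕ, ∃ x : complexBetti (⨁ fun _ : Fin M => A).X (2 * k), IsRationalClass x ∧
        IsOfHodgeType (⨁ fun _ : Fin M => A).dim (⨁ fun _ : Fin M => A).X (2 * k) k k x ∧
        x ∉ divisorClassesSpan (⨁ fun _ : Fin M => A).X (⨁ fun _ : Fin M => A).dim k :=
  exists_simple_degenerate_cyclotomic_two_power (N := 85) (by norm_num) (by decide) (by decide)
    (ZMod.not_isCyclic_units_of_mul_coprime 5 17 (by decide) (by norm_num) (by decide) (by norm_num) (by norm_num))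

/-! ## §2 The complete list of cyclotomic fields -/

/-- **THE COMPLETE CYCLOTOMIC CLASSIFICATION (primitive types).**  `L = ℚ(ζ_N)`, `N ≥ 3`, `φ(N) = 2^{a+1} m` with
`m` odd: every primitive CM type of `L` is nondegenerate **iff** (`m = 1` and `φ(N) ≤ 8`) or (`(ℤ/N)ˣ` is cyclic
and `m ∈ {1} ∪ primes`). [cite: Kubota1965, §4 Lemma 2] [cite: Dodson1984, §3.2.1] [cite: Washington1997,
Thm. 2.5] [cite: Gordon1999HodgeAVSurvey, §9.4.3] -/
theorem forall_isPrimitive_isNondegenerate_iff_cyclotomic_all {N a m : ℕ} (hN : 3 ≤ N) (hm : Odd m)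
    (hφ : N.totient = 2 ^ (a + 1) * m) [IsCyclotomicExtension {N} ℚ L] (φ₀ : L →+* ℂ) :
    (∀ Φ : CMType L, IsPrimitive (ℂ ≃+* ℂ) Φ.1 φ₀ → IsNondegenerate Φ) ↔
      (m = 1 ∧ N.totient ≤ 8) ∨ (IsCyclic (ZMod N)ˣ ∧ (m = 1 ∨ m.Prime)) := by
  by_cases hm1 : m = 1
  · subst hm1
    rw [mul_one] at hφ
    rw [forall_isPrimitive_isNondegenerate_iff_cyclotomic_two_power hN hφ φ₀]
    constructor
    · rintro (h | h)
      · exact Or.inl ⟨rfl, h⟩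
      · exact Or.inr ⟨h, Or.inl rfl⟩
    · rintro (⟨-, h⟩ | ⟨h, -⟩)
      · exact Or.inl h
      · exact Or.inr h
  · rw [forall_isPrimitive_isNondegenerate_iff_cyclotomic hN hm hm1 hφ φ₀,
      ← isCyclic_units_iff_of_three_le hN (ne_four_of_totient_eq hm1 hφ)]
    constructor
    · rintro ⟨hp, hc⟩
      exact Or.inr ⟨hc, Or.inr hp⟩
    · rintro (⟨h, -⟩ | ⟨hc, h | hp⟩)
      · exact absurd h hm1
      · exact absurd h hm1
      · exact ⟨hp, hc⟩

/-- **THE COMPLETE CYCLOTOMIC CLASSIFICATION (simple abelian varieties).**  `φ(N) = 2^{a+1} m`, `m` odd, `N ≥ 3`: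
every SIMPLE abelian variety with complex multiplication by `ℚ(ζ_N)` is nondegenerate (hence satisfies the Hodge
conjecture together with all its powers) **iff** (`m = 1` ∧ `φ(N) ≤ 8`) ∨ (`(ℤ/N)ˣ` cyclic ∧ (`m = 1` ∨ `m` prime)).
[cite: Shimura1998, §6.2 Thm. 3 and §8.2 Prop. 26] [cite: Kubota1965, §4 Lemma 2] [cite: Washington1997, Thm. 2.5] -/
theorem forall_isSimple_isNondegenerate_iff_cyclotomic_all {N a m : ℕ} (hN : 3 ≤ N) (hm : Odd m)
    (hφ : N.totient = 2 ^ (a + 1) * m) [IsCyclotomicExtension {N} ℚ L] :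
    (∀ (Φ : CMType L) (A : AbelianVariety ℂ) (ι : 𝓞 L →+* End A) (θ : L →+* Module.End ℂ (complexBetti A.X 1)),
        IsCMTypeRealisation Φ A ι θ → A.IsSimple → IsNondegenerate Φ) ↔
      (m = 1 ∧ N.totient ≤ 8) ∨ (IsCyclic (ZMod N)ˣ ∧ (m = 1 ∨ m.Prime)) := by
  obtain ⟨hcm, hgal, -, -, -⟩ := cyclotomic_data hN L
  haveI := hcm
  haveI := hgal
  obtain ⟨φ₀⟩ := (inferInstance : Nonempty (L →+* ℂ))
  rw [forall_isSimple_iff_forall_isPrimitive φ₀]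
  exact forall_isPrimitive_isNondegenerate_iff_cyclotomic_all hN hm hφ φ₀

/-- **THE HODGE CONJECTURE FOR ALL POWERS OF ALL SIMPLE ABELIAN VARIETIES WITH CM BY A GOOD CYCLOTOMIC FIELD**
(`(m = 1 ∧ φ(N) ≤ 8) ∨ ((ℤ/N)ˣ cyclic ∧ (m = 1 ∨ m prime))`: e.g. `ℚ(ζ_N)` for `N ≤ 24`, `N ≠ 21`; `ℚ(ζ_p)` with
`p − 1 = 2^s q`; `ℚ(ζ_9)`, `ℚ(ζ_{25})`, `ℚ(ζ_{289})`) — unconditionally (nondegenerate ⟹ `Hdg = Div`, Hazama/Gordon 6.4).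
[cite: Gordon1999HodgeAVSurvey, 5.13 (i) and Thm. 6.4] [cite: Kubota1965, §4 Lemma 2] -/
theorem hodgeConjectureFor_pow_of_isSimple_cyclotomic {N a m : ℕ} (hN : 3 ≤ N) (hm : Odd m)
    (hφ : N.totient = 2 ^ (a + 1) * m) [IsCyclotomicExtension {N} ℚ L]
    (hgood : (m = 1 ∧ N.totient ≤ 8) ∨ (IsCyclic (ZMod N)ˣ ∧ (m = 1 ∨ m.Prime)))
    {Φ : CMType L} {A : AbelianVariety ℂ} {ι : 𝓞 L →+* End A} {θ : L →+* Module.End ℂ (complexBetti A.X 1)}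
    (hA : IsCMTypeRealisation Φ A ι θ) (hs : A.IsSimple) (M : ℕ) :
    HodgeConjectureFor (⨁ fun _ : Fin M => A).dim (⨁ fun _ : Fin M => A).X := by
  obtain ⟨hcm, -, -, -, -⟩ := cyclotomic_data hN L
  haveI := hcm
  exact ((forall_isSimple_isNondegenerate_iff_cyclotomic_all hN hm hφ).2 hgood Φ A ι θ hA hs).hodgeConjectureFor_pow
    hA M

end Field

end Summit.HodgeConjecture.CorCM.AbelianOddPart

end
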